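import Summits.QuantumFields.GaugeBoot.Rows.GLYZc2D3HTab
import HarnessLib

/-!
# Gauge-boot: kernel check of the raw `H` class table, rows 38–88 (part 2/3)

Cell `pub-gaugeboot` (HOME `run/shared/lean/pub/pub-gaugeboot/`), seat lean1 (binding layer for rows C32–C33, C51–C60 = the certified
glyz-c2-rp-3D windows: label sets, class/witness tables, the reduction identity, soundness, per-β bindings).

HONEST FRAMING (page 1 of every file of this cell): certified bounds on lattice expectations at STATED coupling,
gauge group, dimension and torus size; NOT a mass gap, NOT a continuum limit, NOT a string tension, NOT large `N`.
The venture is explicitly NOT Yang–Mills-summit-bearing (barriers `FixedCouplingUltralocality`,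
`PerturbativeInvisibility`).

`hcanon_rows_<lo>_<hi> : ∀ i, lo ≤ i < hi → ∀ j ≥ i, HCanonOK i j`, each range one closed computation (`decide +kernel`);
assembled in `GLYZc2D3Canon`.
-/

noncomputable section

open Literature.MathematicalPhysics.QuantumFieldTheory

namespace Summit.QuantumFields.GaugeBoot

namespace GLYZc2D3

set_option maxHeartbeats 0 in
/-- Rows `38 ≤ i < 47` of the `H` class table canonicalise (1251 entries; closed computation checked by the kernel). -/
theorem hcanon_rows_38_47 : ∀ i : Fin 181, 38 ≤ i.val → i.val < 47 → ∀ j : Fin 181, i.val ≤ j.val → HCanonOK i j := by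
  decide +kernel

set_option maxHeartbeats 0 in
/-- Rows `47 ≤ i < 56` of the `H` class table canonicalise (1170 entries; closed computation checked by the kernel). -/
theorem hcanon_rows_47_56 : ∀ i : Fin 181, 47 ≤ i.val → i.val < 56 → ∀ j : Fin 181, i.val ≤ j.val → HCanonOK i j := by
  decide +kernel

set_option maxHeartbeats 0 in
/-- Rows `56 ≤ i < 66` of the `H` class table canonicalise (1205 entries; closed computation checked by the kernel). -/
theorem hcanon_rows_56_66 : ∀ i : Fin 181, 56 ≤ i.val → i.val < 66 → ∀ j : Fin 181, i.val ≤ j.val → HCanonOK i j := by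
  decide +kernel

set_option maxHeartbeats 0 in
/-- Rows `66 ≤ i < 77` of the `H` class table canonicalise (1210 entries; closed computation checked by the kernel). -/
theorem hcanon_rows_66_77 : ∀ i : Fin 181, 66 ≤ i.val → i.val < 77 → ∀ j : Fin 181, i.val ≤ j.val → HCanonOK i j := by
  decide +kernel

set_option maxHeartbeats 0 in
/-- Rows `77 ≤ i < 89` of the `H` class table canonicalise (1182 entries; closed computation checked by the kernel). -/
theorem hcanon_rows_77_89 : ∀ i : Fin 181, 77 ≤ i.val → i.val < 89 → ∀ j : Fin 181, i.val ≤ j.val → HCanonOK i j := by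
  decide +kernel

end GLYZc2D3

end Summit.QuantumFields.GaugeBoot

end
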